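import Mathlib.LinearAlgebra.TensorProduct.Map
import Mathlib.Algebra.Module.Equiv.Basic
import HarnessLib

/-!
# The homomorphism `GL(M) × GL(N) → GL(P)` induced by an identification `M ⊗ N ≃ P`

Topic `Literature/LinearAlgebra`.  For modules over a commutative semiring `R` and a linear identification
`e : M ⊗[R] N ≃ₗ[R] P`:

* `tensorAutHom e : (M ≃ₗ[R] M) × (N ≃ₗ[R] N) →* (P ≃ₗ[R] P)`, `(A, B) ↦ e ∘ (A ⊗ B) ∘ e⁻¹` — a group
  homomorphism by functoriality of `⊗` (`tensorAutHom_apply_tmul`: it sends `e (x ⊗ₜ y)` to `e (A x ⊗ₜ B y)`);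
* `LinearMap.ext_of_tmul_equiv` / `LinearEquiv.ext_of_tmul_equiv` — maps out of `P` are determined by their
  values on the `e (x ⊗ₜ y)`;
* `tensorAutHom_smulOfUnit_mul` — scalars multiply: `(z₁ A, z₂ B) ↦ z₁ z₂ · (A ⊗ B)`; in particular
  `(z, z⁻¹) ↦ 1` (`tensorAutHom_smulOfUnit_inv`).

This is the operator-model form of the homomorphism `GL(S₁) × GL(S₂) ⟶ GL(S)`, `S = S₁ ⊗ S₂`, through which the
metaplectic group of an orthogonal direct sum `W₁ ⊕ W₂` of symplectic spaces is realised on the tensor product of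
the two Weil representations (Mœglin–Vignéras–Waldspurger, LNM 1291, Chap. 2, II.1, Remarque (6): "un
homomorphisme `GL(S₁) × GL(S₂) ⟶ GL(S)` de noyau l'ensemble des `(z id_{S₁}, z⁻¹ id_{S₂})`"; Kudla, *Notes on
the local theta correspondence* (1996), Chap. I: `j̃((g₁, A(g₁)), (g₂, A(g₂))) = (j(g₁, g₂), A(g₁) ⊗ A(g₂))`).
Only the elementary algebra is here; nothing about Weil representations.

## References

* [MoeglinVignerasWaldspurger1987] C. Mœglin, M.-F. Vignéras, J.-L. Waldspurger, *Correspondances de Howe sur un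
  corps p-adique*, LNM 1291 (1987), Chap. 2, II.1, Rem. (6) — the application.
* [Kudla1996] S. Kudla, *Notes on the local theta correspondence* (1996), Chap. I — the application.
-/

namespace Literature.LinearAlgebra

open scoped TensorProduct

variable {R : Type*} [CommSemiring R] {M N P : Type*} [AddCommMonoid M] [AddCommMonoid N]
  [AddCommMonoid P] [Module R M] [Module R N] [Module R P]

/-- Two linear maps out of `P` agree as soon as they agree on the images `e (x ⊗ₜ y)` of the pure tensors
under an identification `e : M ⊗ N ≃ P`. [folklore] -/
theorem _root_.LinearMap.ext_of_tmul_equiv (e : M ⊗[R] N ≃ₗ[R] P) {Q : Type*} [AddCommMonoid Q] [Module R Q]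
    {f g : P →ₗ[R] Q} (h : ∀ (x : M) (y : N), f (e (x ⊗ₜ[R] y)) = g (e (x ⊗ₜ[R] y))) : f = g := by
  have hcomp : f.comp e.toLinearMap = g.comp e.toLinearMap := TensorProduct.ext' fun x y => h x y
  ext p
  have hp := congrArg (fun φ : M ⊗[R] N →ₗ[R] Q => φ (e.symm p)) hcomp
  simpa using hp

/-- Two linear automorphisms of `P` agree as soon as they agree on the `e (x ⊗ₜ y)`. [folklore] -/
theorem _root_.LinearEquiv.ext_of_tmul_equiv (e : M ⊗[R] N ≃ₗ[R] P) {f g : P ≃ₗ[R] P}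
    (h : ∀ (x : M) (y : N), f (e (x ⊗ₜ[R] y)) = g (e (x ⊗ₜ[R] y))) : f = g :=
  LinearEquiv.toLinearMap_injective (LinearMap.ext_of_tmul_equiv e (f := f.toLinearMap) h)

/-- **`(A, B) ↦ e ∘ (A ⊗ B) ∘ e⁻¹` is a group homomorphism `GL(M) × GL(N) → GL(P)`** for any identification
`e : M ⊗[R] N ≃ₗ[R] P` (functoriality of the tensor product; MVW Chap. 2 II.1 Rem. (6) "un homomorphisme
`GL(S₁) × GL(S₂) ⟶ GL(S)`"). [folklore] -/
def tensorAutHom (e : M ⊗[R] N ≃ₗ[R] P) : (M ≃ₗ[R] M) × (N ≃ₗ[R] N) →* (P ≃ₗ[R] P) where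
  toFun A := e.symm ≪≫ₗ (TensorProduct.congr A.1 A.2 ≪≫ₗ e)
  map_one' := by
    refine LinearEquiv.ext_of_tmul_equiv e fun x y => ?_
    simp only [LinearEquiv.trans_apply, LinearEquiv.symm_apply_apply, TensorProduct.congr_tmul]
    rfl
  map_mul' A B := by
    refine LinearEquiv.ext_of_tmul_equiv e fun x y => ?_
    simp only [LinearEquiv.trans_apply, LinearEquiv.symm_apply_apply, TensorProduct.congr_tmul,
      LinearEquiv.mul_apply]
    rfl

/-- `tensorAutHom e (A, B)` sends `e (x ⊗ₜ y)` to `e (A x ⊗ₜ B y)`. [folklore] -/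
@[simp]
theorem tensorAutHom_apply_tmul (e : M ⊗[R] N ≃ₗ[R] P) (A : (M ≃ₗ[R] M) × (N ≃ₗ[R] N)) (x : M) (y : N) :
    tensorAutHom e A (e (x ⊗ₜ[R] y)) = e (A.1 x ⊗ₜ[R] A.2 y) := by
  simp [tensorAutHom, LinearEquiv.trans_apply, TensorProduct.congr_tmul]

/-- `LinearEquiv.smulOfUnit z` acts as `x ↦ z • x` (definitional unfolding, recorded for rewriting). [folklore] -/
theorem smulOfUnit_apply (z : Rˣ) (x : M) : LinearEquiv.smulOfUnit z x = (z : R) • x := rfl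

/-- **Scalars multiply**: `(z₁ · A, z₂ · B) ↦ (z₁ z₂) · (e ∘ (A ⊗ B) ∘ e⁻¹)` — with `GL(S_j) ∋ z_j · r_j(σ_j)`
the operator coordinates `Mp ≃ Sp × ℂ¹` of the metaplectic groups, this is the multiplicativity of the central
characters under `j̃` (Rao 1993 Prop. 3.7 / Thm 4.1 (3) in Kudla's coordinates). [folklore] -/
theorem tensorAutHom_smulOfUnit_mul (e : M ⊗[R] N ≃ₗ[R] P) (z₁ z₂ : Rˣ) (A : M ≃ₗ[R] M) (B : N ≃ₗ[R] N) :
    tensorAutHom e (LinearEquiv.smulOfUnit z₁ * A, LinearEquiv.smulOfUnit z₂ * B) =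
      LinearEquiv.smulOfUnit (z₁ * z₂) * tensorAutHom e (A, B) := by
  refine LinearEquiv.ext_of_tmul_equiv e fun x y => ?_
  simp only [LinearEquiv.mul_apply, tensorAutHom_apply_tmul, smulOfUnit_apply, map_smul,
    TensorProduct.smul_tmul_smul, Units.val_mul]

/-- In particular `(z · 1, z⁻¹ · 1) ↦ 1`: the pairs `(z id_M, z⁻¹ id_N)` lie in the kernel (MVW: "de noyau
l'ensemble des `(z id_{S₁}, z⁻¹ id_{S₂})`" — only this inclusion is elementary and recorded). [folklore] -/
theorem tensorAutHom_smulOfUnit_inv (e : M ⊗[R] N ≃ₗ[R] P) (z : Rˣ) :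
    tensorAutHom e (LinearEquiv.smulOfUnit z, LinearEquiv.smulOfUnit z⁻¹) = 1 := by
  refine LinearEquiv.ext_of_tmul_equiv e fun x y => ?_
  rw [tensorAutHom_apply_tmul, smulOfUnit_apply, smulOfUnit_apply, TensorProduct.smul_tmul_smul,
    Units.mul_inv, one_smul]
  rfl

end Literature.LinearAlgebra
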